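import Summits.ResolutionOfSingularities.ResolutionOfSingularities.Theorems.WeightedInvariantJFlatEssSmoothFaceLemmas
import Summits.ResolutionOfSingularities.ResolutionOfSingularities.Theorems.WeightedInvariantJFlatEssSmoothDehomog
import Summits.ResolutionOfSingularities.ResolutionOfSingularities.Theorems.WeightedInvariantJFlatEssSmoothLevels
import HarnessLib

/-!
# (c11)≤3 for the flat centre filtration `J₃ᵗ = Iota3.jFlatT`, PART 6b-ii/4 — DESCENT OF ONE CONTACT LEVEL `b ≥ 2` in
# dimension three: the rational correction of the contact parameter (door `HypersurfaceCentreConstruction`,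
# stmt-ResolutionOfSingularities-19897; P3 rung clause (c11)≤3; ORDER (o53) PART 6 = GAP 1′, hand res-L1-w43-stub-3)

Topic: `Summits/ResolutionOfSingularities/ResolutionOfSingularities/Theorems`. Helper for the door item
`HypersurfaceCentreConstruction` (stmt-ResolutionOfSingularities-19897, route `WeightedInvariant`), line `local-engine`
(L W4.3), def-free.  PART 6a (`JFlatEssSmooth.bMax_map_eq_of_corrections`, p547358) reduced the descent of the terminal
contact level along a local, formally smooth, essentially-of-finite-type `φ : S → S'` (`𝔪_S S' = 𝔪_{S'}`) to the hypothesis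
`hcorr`: RATIONAL CORRECTIONS of a better contact parameter.  THIS FILE proves `hcorr` at the levels `b ≥ 2` when
`dim S' = 3` and the level-`b` parameter `y = c 0` of `f` is the first member of a regular system `c = (y, x₁, x₂)` of `S`:

* §1 in-forms: `exists_isInForm_of_mem` (existence, hypothesis-free), `IsInForm.sub`, **`exists_isInForm_face_of_mem_pow`**
  (an element of `𝔪^b`, `b ≥ 2`, has a `Y`-FREE initial form of `U`-degree `b` in the `(b,1,1)`-filtration),
  **`exists_eval_isInForm_of_polynomial`** (a `κ(S)`-polynomial `R₀` of degree `≤ d` is the dehomogenised initial form of an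
  element of `(x₁, x₂)^d ⊆ 𝔪^d`).
* §2 **`exists_correction_of_two_le`** — `f ∉ 𝔪^{ν+1}` at level `b ≥ 2` via `y`, `g' ∈ 𝔪' ∖ 𝔪'²` carrying `φ f` to level
  `b + 1` ⇒ `g' ≡ u · φ(y + r) (mod 𝔪'^{b+1})` with `r ∈ 𝔪_S`, `y + r ∉ 𝔪_S²`, `u ∈ S'ˣ`.  Proof (Hironaka's solvable vertex,
  made relative): normalise `g' = u₀ (φ y + r₁)`, `r₁ ∈ 𝔪'^b` (PART 6a §2); in the `(b,1,1)`-filtration of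
  `c' = φ ∘ c` the initial form of `φ f` in weight `bν` is `in(f) ⊗ κ(S')` (PART 6b-ii/1 base change) AND `ā (Y + R)^ν` with
  `R = in_b(r₁)` a binary form of degree `b` (PART 6b-ii/2 face lemmas, CJS Lemma 8.3 graded calculus); uniqueness of initial
  forms (CJS Lemma 8.3 (1), `dim S' = 3`) equates them, PART 6b-ii/3 (`exists_eq_map_of_face_identity`, via (F4)) makes `R`
  rational, `R = in_b(φ r)` for an `r ∈ (x₁, x₂)^b`, so `r₁ - φ r ∈ F'_{b+1}` and PART 6b-ii/2's correction step gives `u`.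

[OURS · L1 W4.3 · (o53)]  Replaces the role of NO printed item; NOT a statement of the manuscript
[claim: Hironaka2017, status: under-review]. AI work, weaker than expert review.  Pure commutative algebra; no named facts.

## References

* H. Hironaka, *Characteristic polyhedra of singularities*, J. Math. Kyoto Univ. 7 (1967), §3, Thm. (4.8). [Hironaka1967]
* V. Cossart, U. Jannsen, S. Saito, LNM 2270 (2020), Def. 8.2, Lemma 8.3. [CossartJannsenSaito2020]
-/

noncomputable section

open IsLocalRing MvPolynomial Literature.AlgebraicGeometry.Resolution
open Summit.ResolutionOfSingularities.ResolutionOfSingularities.Cruxes.HypersurfaceCentreConstruction.LocalEngine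

set_option linter.dupNamespace false -- mandated namespace of this single-conjunct summit

namespace Summit.ResolutionOfSingularities.ResolutionOfSingularities.Theorems

namespace JFlatEssSmooth

open IotaOrderEssSmooth (mem_maximalIdeal_pow_iff_of_formallySmooth)

/-! ## §1 Initial forms: existence, differences, faces of `𝔪^b`, lifts of rational polynomials -/

section InForms

variable {S : Type} [CommRing S] [IsLocalRing S]

/-- **Existence of initial forms** for `f ∈ F_n` (no hypothesis on `c`: the weight-`n` component of any representative).
[cite: CossartJannsenSaito2020, Def. 8.2] -/
theorem exists_isInForm_of_mem (c : Fin 3 → S) (w : Fin 3 → ℕ) {n : ℕ} {f : S} (hf : f ∈ weightedIdealW c w n) :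
    ∃ P, IsInForm c w n f P := by
  classical
  obtain ⟨G, hG, rfl⟩ := (mem_weightedIdealW_iff_exists_mvPolynomial c w n f).mp hf
  refine ⟨MvPolynomial.map (residue S) (weightedHomogeneousComponent w n G), weightedHomogeneousComponent w n G,
    weightedHomogeneousComponent_isWeightedHomogeneous n G, rfl, ?_⟩
  have := eval_sub_component_mem c w hG
  rwa [map_sub] at this

/-- **Differences**: `in_n(f - g) = in_n(f) - in_n(g)` (same degree). [cite: CossartJannsenSaito2020, Lemma 8.3] -/
theorem IsInForm.sub (c : Fin 3 → S) {w : Fin 3 → ℕ} {n : ℕ} {f g : S} {P Q : MvPolynomial (Fin 3) (ResidueField S)}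
    (hP : IsInForm c w n f P) (hQ : IsInForm c w n g Q) : IsInForm c w n (f - g) (P - Q) := by
  obtain ⟨F, hF, rfl, hFrem⟩ := hP
  obtain ⟨G, hG, rfl, hGrem⟩ := hQ
  refine ⟨F - G, isWeightedHomogeneous_sub hF hG, by rw [map_sub], ?_⟩
  have : f - g - eval c (F - G) = (f - eval c F) - (g - eval c G) := by rw [map_sub]; ring
  rw [this]
  exact Ideal.sub_mem _ hFrem hGrem

/-- The `(b, 1, 1)`-weight of an exponent. [folklore] -/
theorem weight_b11_eq (b : ℕ) (m : Fin 3 →₀ ℕ) : Finsupp.weight ![b, 1, 1] m = b * m 0 + m 1 + m 2 := by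
  rw [Finsupp.weight_apply, Finsupp.sum_fintype _ _ (by simp)]
  simp [Fin.sum_univ_three, mul_comm]

/-- **An element of `𝔪^b` (`b ≥ 2`, `(c) = 𝔪`) has a `Y`-free initial form of `U`-degree `b` in the `(b,1,1)`-filtration**:
write `r = G(c)` with all monomials of `G` of degree `≥ b`; a monomial of degree `≥ b` has `(b,1,1)`-weight `≥ b`, with
equality iff it is `Y`-free of degree `b`; the weight-`b` component of `G` is the witness. [cite: Hironaka1967, §3] -/
theorem exists_isInForm_face_of_mem_pow (c : Fin 3 → S) (hgen : Ideal.span (Set.range c) = maximalIdeal S) {b : ℕ}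
    (hb : 2 ≤ b) {r : S} (hr : r ∈ maximalIdeal S ^ b) :
    ∃ R : MvPolynomial (Fin 3) (ResidueField S), IsInForm c ![b, 1, 1] b r R ∧
      ∀ m ∈ R.support, m 0 = 0 ∧ m 1 + m 2 = b := by
  classical
  rw [← weightedIdealW_one_eq_pow c hgen b] at hr
  obtain ⟨G, hG, rfl⟩ := (mem_weightedIdealW_iff_exists_mvPolynomial c _ b r).mp hr
  have hmin : ∀ m ∈ G.support, b ≤ Finsupp.weight ![b, 1, 1] m := fun m hm => by
    have h1 := hG m hm
    rw [weight_one_eq] at h1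
    rw [weight_b11_eq]
    nlinarith
  refine ⟨MvPolynomial.map (residue S) (weightedHomogeneousComponent ![b, 1, 1] b G),
    ⟨weightedHomogeneousComponent _ b G, weightedHomogeneousComponent_isWeightedHomogeneous b G, rfl, ?_⟩, ?_⟩
  · have := eval_sub_component_mem c _ hmin
    rwa [map_sub] at this
  · intro m hm
    have hm' : m ∈ (weightedHomogeneousComponent ![b, 1, 1] b G).support := support_map_subset _ _ hm
    rw [mem_support_iff, coeff_weightedHomogeneousComponent] at hm'
    by_cases hwm : Finsupp.weight ![b, 1, 1] m = b
    · rw [if_pos hwm] at hm'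
      have hG' := hG m (mem_support_iff.mpr hm')
      rw [weight_one_eq] at hG'
      rw [weight_b11_eq] at hwm
      have h0 : m 0 = 0 := by
        by_contra h
        have h1 : 1 ≤ m 0 := Nat.one_le_iff_ne_zero.mpr h
        nlinarith
      refine ⟨h0, ?_⟩
      rw [h0, mul_zero, zero_add] at hwm
      exact hwm
    · rw [if_neg hwm] at hm'
      exact absurd rfl hm'

/-- **Lifting a rational polynomial to an element of `(c 1, c 2)^d`**: for `R₀ ∈ κ(S)[X]` there is `r ∈ 𝔪^d` whose
`(b,1,1)`-initial form in weight `d` is the homogenisation `Σ_{i ≤ d} (R₀)_i U₁^i U₂^{d-i}` (`r = Σ_i s_i (c 1)^i (c 2)^{d-i}`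
for lifts `s_i` of the coefficients). [folklore] -/
theorem exists_eval_isInForm_of_polynomial (c : Fin 3 → S) (hc1 : c 1 ∈ maximalIdeal S) (hc2 : c 2 ∈ maximalIdeal S)
    (b d : ℕ) (R₀ : Polynomial (ResidueField S)) :
    ∃ r : S, r ∈ maximalIdeal S ^ d ∧ IsInForm c ![b, 1, 1] d r
      (∑ i ∈ Finset.range (d + 1), monomial (Finsupp.single 1 i + Finsupp.single 2 (d - i)) (R₀.coeff i)) := by
  classical
  have hres : Function.Surjective (residue S) := Ideal.Quotient.mk_surjective
  choose s hs using fun i : ℕ => hres (R₀.coeff i)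
  refine ⟨eval c (∑ i ∈ Finset.range (d + 1), monomial (Finsupp.single 1 i + Finsupp.single 2 (d - i)) (s i)), ?_,
    ∑ i ∈ Finset.range (d + 1), monomial (Finsupp.single 1 i + Finsupp.single 2 (d - i)) (s i), ?_, ?_, ?_⟩
  · rw [map_sum]
    refine Ideal.sum_mem _ fun i hi => ?_
    have hi' := Finset.mem_range.mp hi
    rw [eval_monomial_eq_monom3]
    refine Ideal.mul_mem_left _ _ ?_
    have hmon : monom3 c (Finsupp.single 1 i + Finsupp.single 2 (d - i)) = c 1 ^ i * c 2 ^ (d - i) := by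
      simp [monom3]
    rw [hmon]
    have hmem : c 1 ^ i * c 2 ^ (d - i) ∈ maximalIdeal S ^ (i + (d - i)) := by
      rw [pow_add]
      exact Ideal.mul_mem_mul (Ideal.pow_mem_pow hc1 i) (Ideal.pow_mem_pow hc2 (d - i))
    rwa [Nat.add_sub_cancel' (by omega : i ≤ d)] at hmem
  · refine IsWeightedHomogeneous.sum _ _ _ fun i hi => ?_
    have hi' := Finset.mem_range.mp hi
    refine isWeightedHomogeneous_monomial _ _ _ ?_
    rw [weight_b11_eq]
    simp
    omega
  · rw [map_sum]
    refine Finset.sum_congr rfl fun i _ => ?_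
    rw [map_monomial, hs]
  · rw [sub_self]
    exact zero_mem _

end InForms

/-! ## §2 The rational correction at a level `b ≥ 2` -/

section Descent

variable {S S' : Type} [CommRing S] [CommRing S'] [IsRegularLocalRing S] [IsRegularLocalRing S'] [Algebra S S']
  [IsLocalHom (algebraMap S S')] [Algebra.FormallySmooth S S'] [Algebra.EssFiniteType S S']

/-- **DESCENT OF ONE CONTACT LEVEL, `b ≥ 2`, DIMENSION THREE (the rational correction).**  `φ : S → S'` a local,
formally smooth, essentially-of-finite-type homomorphism of regular local rings with `𝔪_S S' = 𝔪_{S'}` and `dim S' = 3`;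
`c = (y, x₁, x₂)` a regular system of parameters of `S` (`y = c 0 ∉ 𝔪²`); `f ∉ 𝔪^{ν+1}` (`ν ≥ 1`) reaching level `b ≥ 2`
via `y`; `g' ∈ 𝔪' ∖ 𝔪'²` carrying `φ f` to level `b + 1`.  Then `g' ≡ u · φ(y + r) (mod 𝔪'^{b+1})` for some `r ∈ 𝔪_S` with
`y + r ∉ 𝔪_S²` and a unit `u` — the hypothesis `hcorr` of PART 6a `bMax_map_eq_of_corrections` at the levels `b ≥ 2`.
[cite: Hironaka1967, §3, Thm. (4.8)] [OURS · L1 W4.3 · (o53) GAP 1″] -/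
theorem exists_correction_of_two_le (h𝔪 : (maximalIdeal S).map (algebraMap S S') = maximalIdeal S')
    (hdim' : ringKrullDim S' = 3) (c : Fin 3 → S) (hgen : Ideal.span {c 0, c 1, c 2} = maximalIdeal S)
    (hy2 : c 0 ∉ maximalIdeal S ^ 2) {f : S} {ν b : ℕ} (hν : 1 ≤ ν) (hb : 2 ≤ b)
    (hford : f ∉ maximalIdeal S ^ (ν + 1)) (hfy : f ∈ contactFiltration (c 0) b (b * ν)) {g' : S'}
    (hg' : g' ∈ maximalIdeal S') (hg'2 : g' ∉ maximalIdeal S' ^ 2)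
    (hfg' : algebraMap S S' f ∈ contactFiltration g' (b + 1) ((b + 1) * ν)) :
    ∃ (r : S) (u : S'), r ∈ maximalIdeal S ∧ c 0 + r ∉ maximalIdeal S ^ 2 ∧ IsUnit u ∧
      g' - u * algebraMap S S' (c 0 + r) ∈ maximalIdeal S' ^ (b + 1) := by
  classical
  haveI := FormallySmoothField.formallySmooth_residueField S S' h𝔪
  haveI := FormallySmoothField.essFiniteType_residueField S S'
  have hb1 : 1 ≤ b := le_trans one_le_two hb
  -- the two coordinate systems
  have hc3 : ![c 0, c 1, c 2] = c := by funext i; fin_cases i <;> rfl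
  have hc'3 : ![algebraMap S S' (c 0), algebraMap S S' (c 1), algebraMap S S' (c 2)] = algebraMap S S' ∘ c := by
    funext i; fin_cases i <;> rfl
  have hgenr : Ideal.span (Set.range c) = maximalIdeal S := span_range_eq_of_span_triple c hgen
  have hci : ∀ i, c i ∈ maximalIdeal S := fun i => hgenr ▸ Ideal.subset_span ⟨i, rfl⟩
  have hc'i : ∀ i, (algebraMap S S' ∘ c) i ∈ maximalIdeal S' := fun i => h𝔪 ▸ Ideal.mem_map_of_mem _ (hci i)
  have hgen' : Ideal.span {algebraMap S S' (c 0), algebraMap S S' (c 1), algebraMap S S' (c 2)} = maximalIdeal S' := by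
    rw [← h𝔪, ← hgen, Ideal.map_span, Set.image_insert_eq, Set.image_insert_eq, Set.image_singleton]
  have hgen'3 : Ideal.span {(algebraMap S S' ∘ c) 0, (algebraMap S S' ∘ c) 1, (algebraMap S S' ∘ c) 2} =
      maximalIdeal S' := hgen'
  have hgen'r : Ideal.span (Set.range (algebraMap S S' ∘ c)) = maximalIdeal S' :=
    span_range_eq_of_span_triple _ hgen'3
  have hwpos : ∀ i, 0 < (![b, 1, 1] : Fin 3 → ℕ) i := fun i => by fin_cases i <;> (simp; try omega)
  have hφy : algebraMap S S' (c 0) ∈ maximalIdeal S' := hc'i 0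
  have hφy2 : algebraMap S S' (c 0) ∉ maximalIdeal S' ^ 2 := fun h =>
    hy2 ((mem_maximalIdeal_pow_iff_of_formallySmooth S S' 2 (c 0)).mpr h)
  have hford' : algebraMap S S' f ∉ maximalIdeal S' ^ (ν + 1) := fun h =>
    hford ((mem_maximalIdeal_pow_iff_of_formallySmooth S S' _ f).mpr h)
  -- Step A: normalise `g' = u₀ (φ y + r₁)`, `r₁ ∈ 𝔪'^b`
  have hfy' : algebraMap S S' f ∈ contactFiltration (algebraMap S S' (c 0)) b (b * ν) :=
    (EssSmoothLevels.algebraMap_mem_contactFiltration_iff h𝔪 f (c 0) b _).mpr hfy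
  obtain ⟨u₀, hu₀⟩ := exists_unit_sub_mul_mem_pow_of_levels hφy hφy2 hg' hg'2 hb hν hford' hfy' hfg'
  set r₁ : S' := ↑u₀⁻¹ * (g' - ↑u₀ * algebraMap S S' (c 0)) with hr₁
  have hr₁b : r₁ ∈ maximalIdeal S' ^ b := Ideal.mul_mem_left _ _ hu₀
  have hg₁ : (↑u₀⁻¹ : S') * g' = algebraMap S S' (c 0) + r₁ := by
    rw [hr₁, mul_sub, ← mul_assoc, Units.inv_mul, one_mul]
    ring
  have hg₁𝔪 : algebraMap S S' (c 0) + r₁ ∈ maximalIdeal S' := Ideal.add_mem _ hφy (Ideal.pow_le_self (by omega) hr₁b)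
  have hfg₁ : algebraMap S S' f ∈ contactFiltration (algebraMap S S' (c 0) + r₁) (b + 1) ((b + 1) * ν) := by
    rw [contactFiltration_eq_of_sub_unit_mul_mem_pow (u₀⁻¹).isUnit
      (show algebraMap S S' (c 0) + r₁ - ↑u₀⁻¹ * g' ∈ maximalIdeal S' ^ (b + 1) by
        rw [hg₁, sub_self]; exact zero_mem _)]
    exact hfg'
  -- the `(b,1,1)`-filtration of `c' = φ ∘ c` is the contact filtration of `φ y + r₁` at weight `b`
  have hW' : ∀ n, weightedIdealW (algebraMap S S' ∘ c) ![b, 1, 1] n =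
      contactFiltration (algebraMap S S' (c 0) + r₁) b n := fun n => by
    rw [← hc'3, weightedIdealW_eq_contactFiltration _ _ _ hgen' hb1 n]
    refine (contactFiltration_eq_of_sub_unit_mul_mem_pow isUnit_one ?_ n).symm
    rw [one_mul, add_sub_cancel_left]
    exact hr₁b
  -- Step B: the face of `φ f` read from `g₁ = φ y + r₁`
  obtain ⟨aν, haν, w₁, hw₁, hsum⟩ :=
    Submodule.mem_sup.mp (mem_span_pow_sup_of_level_succ (algebraMap S S' (c 0) + r₁) b ν hfg₁)
  obtain ⟨a, rfl⟩ := Ideal.mem_span_singleton'.mp haν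
  have ha : IsUnit a := isUnit_of_level_face hg₁𝔪 hb1 hsum.symm hw₁ hford'
  have ha0 : residue S' a ≠ 0 := fun h =>
    (IsLocalRing.mem_maximalIdeal a).mp ((residue_eq_zero_iff a).mp h) ha
  obtain ⟨R, hR, hRface⟩ := exists_isInForm_face_of_mem_pow (algebraMap S S' ∘ c) hgen'r hb hr₁b
  have hin_g₁ : IsInForm (algebraMap S S' ∘ c) ![b, 1, 1] b (algebraMap S S' (c 0) + r₁) (X 0 + R) :=
    IsInForm.add _ (isInForm_coord_zero (algebraMap S S' ∘ c) ![b, 1, 1]) hR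
  have hin_rhs : IsInForm (algebraMap S S' ∘ c) ![b, 1, 1] (b * ν) (algebraMap S S' f)
      (C (residue S' a) * (X 0 + R) ^ ν) := by
    have h1 := IsInForm.smul _ (IsInForm.pow (algebraMap S S' ∘ c) hin_g₁ ν) a
    have h2 : IsInForm (algebraMap S S' ∘ c) ![b, 1, 1] (b * ν) w₁ 0 :=
      isInForm_zero_of_mem_succ _ (by rw [hW']; exact hw₁)
    have h3 := IsInForm.add _ h1 h2
    rw [add_zero, hsum] at h3
    exact h3
  -- the same face read from `S`
  have hfW : f ∈ weightedIdealW c ![b, 1, 1] (b * ν) := by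
    rw [← hc3, weightedIdealW_eq_contactFiltration _ _ _ hgen hb1]
    exact hfy
  obtain ⟨P, hP⟩ := exists_isInForm_of_mem c ![b, 1, 1] hfW
  have hin_lhs : IsInForm (algebraMap S S' ∘ c) ![b, 1, 1] (b * ν) (algebraMap S S' f)
      (MvPolynomial.map (algebraMap (ResidueField S) (ResidueField S')) P) := IsInForm.baseChange hP
  have hPQ := IsInForm.unique _ hgen'3 hdim' hwpos hin_lhs hin_rhs
  -- Step C: the form `R` is rational
  obtain ⟨R₀, hR₀⟩ := exists_eq_map_of_face_identity (ResidueField S) (ResidueField S') hν ha0 hRface hPQ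
  -- Step D: lift to `S`
  obtain ⟨r, hrb, hin_r⟩ := exists_eval_isInForm_of_polynomial c (hci 1) (hci 2) b b R₀
  have hr𝔪 : r ∈ maximalIdeal S := Ideal.pow_le_self (by omega) hrb
  have hφrb : algebraMap S S' r ∈ maximalIdeal S' ^ b := by
    have := Ideal.mem_map_of_mem (algebraMap S S') hrb
    rwa [Ideal.map_pow, h𝔪] at this
  have hin_φr : IsInForm (algebraMap S S' ∘ c) ![b, 1, 1] b (algebraMap S S' r) R := by
    have := IsInForm.baseChange (T := S') hin_r
    rwa [← hR₀] at this
  -- Step E: `r₁ - φ r ∈ F'_{b+1}`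
  have hdiff : r₁ - algebraMap S S' r ∈ weightedIdealW (algebraMap S S' ∘ c) ![b, 1, 1] (b + 1) := by
    have := IsInForm.sub _ hR hin_φr
    rw [sub_self] at this
    exact IsInForm.mem_succ_of_zero _ hgen'r hwpos this
  rw [← hc'3] at hdiff
  -- Step F: the unit
  obtain ⟨u, hu, hcong⟩ := exists_unit_correction_of_mem_weightedIdealW_succ hgen' hφy2 hb hr₁b hφrb hdiff
  refine ⟨r, ↑u₀ * u, hr𝔪, ?_, u₀.isUnit.mul hu, ?_⟩
  · intro h
    apply hy2
    have : c 0 = (c 0 + r) - r := by ring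
    rw [this]
    exact Ideal.sub_mem _ h (Ideal.pow_le_pow_right hb hrb)
  · have key : g' - ↑u₀ * u * algebraMap S S' (c 0 + r) =
        ↑u₀ * ((algebraMap S S' (c 0) + r₁) - u * (algebraMap S S' (c 0) + algebraMap S S' r)) := by
      rw [← hg₁, map_add, mul_sub, ← mul_assoc, Units.mul_inv, one_mul]
      ring
    rw [key]
    exact Ideal.mul_mem_left _ _ hcong

end Descent

end JFlatEssSmooth

end Summit.ResolutionOfSingularities.ResolutionOfSingularities.Theorems

end
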